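import Literature.MathematicalPhysics.QuantumFieldTheory.BalabanImbrieJaffe1984to88.BIJ85LandauMinimizer442V1
import Literature.MathematicalPhysics.QuantumFieldTheory.BalabanImbrieJaffe1984to88.BIJ85GaugeFunction5113
import Literature.MathematicalPhysics.QuantumFieldTheory.Balaban1983to89.B5AveragingLocalityV1
import Literature.MathematicalPhysics.QuantumFieldTheory.Balaban1983to89.B5Eq147TorusBridge

/-!
# `Balaban1983to89.B6Eq28LandauGaugeV1` — T. Bałaban, *Propagators and renormalization transformations for lattice gauge
theories. II*, Commun. Math. Phys. **96** (1984) 223–250 [Balaban1984PropagatorsII], Sect. A pp. 224–225, (2.8)–(2.9), (2.12):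
«from each orbit of the gauge group we choose a minimum of the functional Σ η^d|(∂*A^λ)(x)|²» — the (generalized, block)
LANDAU GAUGE AS A CONSTRAINED MINIMUM, its Euler equation (2.9), «exactly one minimum on each orbit», and (2.12) «R∂*A = 0»,
PROVED ONE LEVEL on the V1 lattice calculus (r18's `LatticeFieldCalculus.landauFunctional` / `IsLandauGauge`), and identified
with the `k = 1` Landau subspace of [Balaban1984PropagatorsI] (1.47) / [BalabanImbrieJaffe1985] (4.4.2)

statement-level skeleton of published theorems with citation tags; proofs where landed; nothing here is a claim about the Yang–Mills mass gap

PDF held: `paper:balaban1984-cmp96-propagators-rt-ii` (journal page = PDF page + 222); pp. 224–225 [PDF 2–3] read from the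
materialised text `~/.lit/texts/paper-balaban1984-cmp96-propagators-rt-ii/p0002.txt` (ll. 25–37) and `p0003.txt` (ll. 1–11).

PRINT, verbatim.  p. 224 [PDF 2]: «The functional and the conditions are invariant with respect to gauge transformations
λ : A → A^λ = A − ∂λ such that λ = 0 on Λ₀, Q′_jλ = 0 on Λ_j, j = 1, …, k. (2.7) These gauge transformations form a group and we
consider orbits of this group. … We will use a generalization of the gauge condition R∂*A = 0 defined and used in Sects. C and D
of [4]. This generalization can be defined in the following way: from each orbit of the gauge group we choose a minimum of the
functional Σ_x η^d|(∂*A^λ)(x)|² = Σ_x η^d|(∂*A)(x) − (Δλ)(x)|², λ = 0 on Λ₀, Q′_jλ = 0 on Λ_j, j = 1, …, k. (2.8) If λ₀ defines a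
minimum, then we have the equation Σ_x η^d(Δδλ)(x)((∂*A)(x) − (Δλ₀)(x)) = 0, (2.9)»  p. 225 [PDF 3]: «where λ₀, δλ satisfy (2.7)
and besides this δλ is arbitrary. Let us denote N(Q′) = {λ : λ satisfies (2.7)}, (2.10) and let R be an orthogonal projection in
the space L²(T_η) onto the subspace ΔN(Q′). Equation (2.9) implies Δλ₀ = R∂*A, and this equation has exactly one solution because
the Laplace operator Δ is positive on the subspace N(Q′), hence it is invertible on this subspace. … Thus the functional (2.8) has
exactly one minimum on each orbit. This minimum satisfies the equation R∂*A^{λ₀} = 0, or R∂*A = 0 if we take A^{λ₀} as A. (2.12)»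

CITATION HEADER (lean-in-tree rule) — WHAT IS REPRODUCED.  Phase-2 file of the `lit-balaban` typed skeleton (HOME
`run/shared/lean/pub/lit-balaban/`), seat p16 gen 4: the PROOF, at ONE LEVEL on the V1 calculus, of the SKELETON rows **B5.Eq2.8-1.27**
(r18's cross-paper row X05 «(generalized, block) LANDAU GAUGE: minimize Σ η^d|(∂*A^λ)(x)|² … Euler–Lagrange (2.9)», typed p239225
as `LatticeFieldCalculus.landauFunctional` (2.8) and `LatticeFieldCalculus.IsLandauGauge` (2.9) — abelian, one level: `N(Q′) = {λ :
Q′λ = 0}`, `Q′ = siteAvg : T^{(j)} → T^{(j+1)}`, `Λ₀ = ∅`), **B6.Eq2.8** ((2.8)–(2.9); r03's abstract Hilbert-space form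
`B6SectA.norm_sub_repr217_le`/`inner_sub_repr217_eq_zero` — untouched) and **B6.Eq2.12** ((2.12)), and their KNITTING with the
`k = 1` Landau subspaces of [Balaban1984PropagatorsI] (1.47) (`B5Eq147Landau.Lan`, tower; p16 gen 2) and [BalabanImbrieJaffe1985]
(4.4.2) (`B5Eq164LandauV1.lan`, V1 `BondSpace`, with p11's orthogonal projection `LandauOps.projR`; p38 gen 3) through this seat's
`B5Eq147TorusBridge` (gen 4, p253956) — the knitting (§3: `IsLandauGauge c A ↔ tV A ∈ B5Eq147Landau.Lan L (Mk P 1) 1 ↔ toLp A ∈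
B5Eq164LandauV1.lan P 1 c′ s′ ↔ R∂*A = 0` with p11's `projR`) is built and follows as the append-only v1.1 of THIS file as soon as
the farm serves the olean of `B5Eq147TorusBridge` (v1 = §0–§2, self-contained on `LatticeFieldCalculus`; v1.1 = + §3, the v1
declarations byte-identical).  Objects BY NAME:
`LatticeFieldCalculus` (`siteAvg`, `grad`, `diverg`, `laplace`, `gaugeShift`, `landauFunctional`, `landauFunctional_eq`,
`IsLandauGauge`, `diverg_gaugeShift`, `siteAvg_const`; r18), `BIJ85GaugeFunction5113` (`siteAvg_add/sub/smul`; p08),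
`B5Positivity172Lattice.const_of_laplace_eq_zero` («ker Δ = constants», p11), `B5AveragingLocalityV1.siteAvg_zero`.  NO new
definition (theorems only); no `def … : Prop`, nothing is a named unproved fact.

WHAT IS PROVED (kernel, no `sorry`, standard axioms; every level `j`, every `d ≥ 1`, odd `L > 1`; `w` = the weight `η^d`, `c` =
the lattice factor of `∂*`, `Δ`):
* §0 linearity `laplace_add/smul/sub/zero`, `diverg_gaugeShift_apply` ((2.8) `∂*A^λ = ∂*A − Δλ` pointwise), `gaugeShift_gaugeShift`.
* §1 **(2.8) ⟺ (2.9)**: `landauFunctional_add` (the exact second-order expansion of (2.8) along the orbit), `eq_zero_of_quadratic_min`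
  ([folklore]), **`isLandauGauge_of_isMinOn`** — «If λ₀ defines a minimum, then we have the equation (2.9)» (`w > 0`),
  **`isMinOn_of_isLandauGauge`** — the converse (`F(λ) = F(λ₀) + w·Σ(Δ(λ−λ₀))²`, any `w ≥ 0`), `isMinOn_iff_isLandauGauge`,
  `isLandauGauge_iff_isMinOn_zero` (the reading «R∂*A = 0 if we take A^{λ₀} as A»: `A` is in the Landau gauge iff `λ = 0` minimises
  (2.8) on its orbit).
* §2 **«exactly one»**: `eq_zero_of_siteAvg_eq_zero_of_laplace_eq_zero` (`Q′λ = 0 ∧ Δλ = 0 ⇒ λ = 0`, level `j`, `c ≠ 0`),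
  **`landauGauge_unique`**, **`exists_landauGauge`** («Δλ₀ = R∂*A»: orthogonal projection of `∂*A` onto `ΔN(Q′) ⊂ ℓ²(T^{(j)})`, any
  `c`), **`existsUnique_landauGauge`** («this equation has exactly one solution», `c ≠ 0`), **`existsUnique_isMinOn`** («Thus the
  functional (2.8) has exactly one minimum on each orbit», `w > 0`, `c ≠ 0`), `landauRep_unique`, `eq_of_isLandauGauge_of_gaugeShift`
  (two Landau-gauge fields of one orbit are equal).
* §3 (v1.1, append-only, 2026-08-21): **(2.12) «R∂*A = 0»** on the finest lattice `T^{(0)}` (`1 ≤ m + K`): `siteAvgIter_one`,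
  `isLandauGauge_iff_one` (the condition does not see `c ≠ 0`), **`isLandauGauge_iff_tV_mem_Lan`** (`IsLandauGauge c A ↔ tV A ∈
  B5Eq147Landau.Lan L (Mk P 1) 1`), **`isLandauGauge_iff_mem_lan`** (`↔ toLp A ∈ B5Eq164LandauV1.lan P 1 c′ s′`),
  **`isLandauGauge_iff_projR_eq_zero`** (`↔ R ∂*A = 0` with p11's orthogonal projection `R = LandauOps.projR` onto `ΔN(Q′)` — (2.12)
  literally): the one-level V1 Landau gauge of r18 IS the `k = 1` Landau gauge of [B5] (1.47)/[BIJ85] (4.4.2) in both formalizations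
  (via this seat's `B5Eq147TorusBridge.tV_mem_Lan_iff_sum` / `mem_lan_iff_sum`, p253956).

HONEST SCOPE (kept from r18's typing, `LatticeFieldCalculus` §Landau «TODO(general form)»): ONE LEVEL — `k = 1`, `Ω₁ = T_η` (the
whole torus), `Λ₀ = ∅`, so `N(Q′) = {λ : Q′λ = 0}` with the one-step `Q′ = siteAvg`; the multi-domain constraints «λ = 0 on Λ₀,
Q′_jλ = 0 on Λ_j» of (2.7)–(2.8) with the domain sequences (2.1)–(2.4) are the B6 Sect. A V1 programme of seat p21 gen 5
(`B6SectADomainsV1`, `B6SectAZeroModesV1`, …; not touched) and r03's abstract `B6SectA`; (2.11) (the quantitative positivity of Δ on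
N(Q′)) is row B6.Eq2.11 (refuted as printed / repaired, p242700) — only its qualitative content «Δ invertible on N(Q′)» is used here,
as a theorem (`eq_zero_of_siteAvg_eq_zero_of_laplace_eq_zero`).  U = 1, real (abelian) fields; the weight `w = η^d` enters (2.8) as a
constant factor and is immaterial for the minimiser (`w > 0`).

Unit `lit-balaban-p16` gen 4 (Phase-2 proof seat p16; literature-prover-lit-balaban-p16-g4-0), HOME `run/shared/lean/pub/lit-balaban/`
(STATUS: `lit-balaban-p16/STATUS.md`), 2026-08-21.
-/

open scoped BigOperators InnerProductSpace

namespace Literature.MathematicalPhysics.QuantumFieldTheory.Balaban1983to89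

namespace B6Eq28LandauGaugeV1

open LatticeFieldCalculus
open Literature.MathematicalPhysics.QuantumFieldTheory.BalabanImbrieJaffe1984to88.BIJ85GaugeFunction5113
  (siteAvg_add siteAvg_sub siteAvg_smul)

noncomputable section

variable {P : Params} {j : ℕ}

/-! ## §0  Linearity of `Δ` and of the gauge action (one level, real fields) -/

/-- `Δ(f + g) = Δf + Δg`. [cite: Balaban1984PropagatorsI, (1.21) p.21] -/
theorem laplace_add (c : ℝ) (f g : SiteField P j ℝ) : laplace c (f + g) = laplace c f + laplace c g := by
  funext x
  simp only [laplace, Pi.add_apply, smul_eq_mul, ← Finset.sum_add_distrib]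
  exact Finset.sum_congr rfl fun μ _ => by ring

/-- `Δ(a·f) = a·Δf`. [cite: Balaban1984PropagatorsI, (1.21) p.21] -/
theorem laplace_smul (c a : ℝ) (f : SiteField P j ℝ) : laplace c (a • f) = a • laplace c f := by
  funext x
  simp only [laplace, Pi.smul_apply, smul_eq_mul, Finset.mul_sum]
  exact Finset.sum_congr rfl fun μ _ => by ring

/-- `Δ(f − g) = Δf − Δg`. [cite: Balaban1984PropagatorsI, (1.21) p.21] -/
theorem laplace_sub (c : ℝ) (f g : SiteField P j ℝ) : laplace c (f - g) = laplace c f - laplace c g := by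
  rw [sub_eq_add_neg, laplace_add, ← neg_one_smul ℝ g, laplace_smul, neg_one_smul, ← sub_eq_add_neg]

/-- `Δ0 = 0`. [cite: Balaban1984PropagatorsI, (1.21) p.21] -/
theorem laplace_zero (c : ℝ) : laplace c (0 : SiteField P j ℝ) = 0 := by
  have h := laplace_smul (P := P) (j := j) c 0 0
  rwa [zero_smul, zero_smul] at h

/-- **(2.8), left side = right side**: `∂*A^{λ} = ∂*A − Δλ` pointwise (r18's `diverg_gaugeShift`).
[cite: Balaban1984PropagatorsII, (2.8) p.224] -/
theorem diverg_gaugeShift_apply (c : ℝ) (lam : SiteField P j ℝ) (A : VecField P j ℝ) (x : Site P j) :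
    diverg c (gaugeShift c lam A) x = diverg c A x - laplace c lam x := by
  rw [diverg_gaugeShift]

/-- composing gauge transformations: `(A^{λ₀})^{δ} = A^{λ₀ + δ}`. [cite: Balaban1984PropagatorsII, (2.7) p.224] -/
theorem gaugeShift_gaugeShift (c : ℝ) (l₀ δ : SiteField P j ℝ) (A : VecField P j ℝ) :
    gaugeShift c δ (gaugeShift c l₀ A) = gaugeShift c (l₀ + δ) A := by
  funext b
  simp only [gaugeShift, grad, Pi.add_apply, smul_eq_mul]
  ring

/-! ## §1  (2.8) ⟺ (2.9): «If λ₀ defines a minimum, then we have the equation (2.9)» — and conversely -/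

/-- **the second variation of (2.8)**: for every `λ₀, δ`,
`F(λ₀ + δ) = F(λ₀) − 2w·Σ_x (Δδ)(x)(∂*A^{λ₀})(x) + w·Σ_x (Δδ)(x)²` (`F = landauFunctional w c A`, a quadratic polynomial along
every line of the orbit). [cite: Balaban1984PropagatorsII, (2.8) p.224] -/
theorem landauFunctional_add (w c : ℝ) (A : VecField P j ℝ) (l₀ δ : SiteField P j ℝ) :
    landauFunctional w c A (l₀ + δ)
      = landauFunctional w c A l₀
        - 2 * w * ∑ x : Site P j, laplace c δ x * diverg c (gaugeShift c l₀ A) x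
        + w * ∑ x : Site P j, laplace c δ x ^ 2 := by
  rw [landauFunctional_eq, landauFunctional_eq, laplace_add, Finset.mul_sum, Finset.mul_sum, ← Finset.sum_sub_distrib,
    ← Finset.sum_add_distrib]
  refine Finset.sum_congr rfl fun x _ => ?_
  rw [diverg_gaugeShift_apply, Pi.add_apply]
  ring

/-- the one-variable calculus step behind «If λ₀ defines a minimum, then we have the equation (2.9)»: a quadratic `a − 2bt + qt²`
(`q ≥ 0`) that is `≥ a` for every real `t` has `b = 0`. [cite: Balaban1984PropagatorsII, (2.9) p.224] -/
theorem eq_zero_of_quadratic_min {a b q : ℝ} (hq : 0 ≤ q) (h : ∀ t : ℝ, a ≤ a - 2 * b * t + q * t ^ 2) : b = 0 := by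
  have h1 := h (b / (q + 1))
  have hq1 : 0 < q + 1 := by linarith
  have key : b ^ 2 * (q + 2) ≤ 0 := by
    have h2 : 0 ≤ -2 * b * (b / (q + 1)) + q * (b / (q + 1)) ^ 2 := by linarith
    have h3 : -2 * b * (b / (q + 1)) + q * (b / (q + 1)) ^ 2 = -(b ^ 2 * (q + 2)) / (q + 1) ^ 2 := by
      field_simp
      ring
    rw [h3, le_div_iff₀ (by positivity), zero_mul] at h2
    linarith
  nlinarith [sq_nonneg b]

/-- **(2.8) ⟹ (2.9) AS PRINTED** — «from each orbit of the gauge group we choose a minimum of the functional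
Σ η^d|(∂*A^λ)(x)|² = Σ η^d|(∂*A)(x) − (Δλ)(x)|², Q′λ = 0 (2.8). If λ₀ defines a minimum, then we have the equation
Σ η^d(Δδλ)(x)((∂*A)(x) − (Δλ₀)(x)) = 0, (2.9) where λ₀, δλ satisfy (2.7) and besides this δλ is arbitrary»: ONE LEVEL on the V1
calculus (`N(Q′) = {λ : Q′λ = 0}`, `Q′ = siteAvg`, `Λ₀ = ∅`; the weight `w = η^d > 0`): a minimiser `λ₀ ∈ N(Q′)` of r18's
`landauFunctional w c A` over `N(Q′)` puts `A^{λ₀}` in r18's `IsLandauGauge c` (which IS (2.9), written for `A^{λ₀}`).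
[cite: Balaban1984PropagatorsII, (2.9) p.224] -/
theorem isLandauGauge_of_isMinOn {w : ℝ} (hw : 0 < w) (c : ℝ) (A : VecField P j ℝ) {l₀ : SiteField P j ℝ}
    (h₀ : siteAvg l₀ = 0) (hmin : IsMinOn (landauFunctional w c A) {lam | siteAvg lam = 0} l₀) :
    IsLandauGauge c (gaugeShift c l₀ A) := by
  intro δ hδ
  have hline : ∀ t : ℝ, landauFunctional w c A l₀ ≤
      landauFunctional w c A l₀ - 2 * (w * ∑ x : Site P j, laplace c δ x * diverg c (gaugeShift c l₀ A) x) * t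
        + (w * ∑ x : Site P j, laplace c δ x ^ 2) * t ^ 2 := by
    intro t
    have hmem : l₀ + t • δ ∈ {lam : SiteField P j ℝ | siteAvg lam = 0} := by
      show siteAvg (l₀ + t • δ) = 0
      rw [siteAvg_add, siteAvg_smul, h₀, hδ, smul_zero, add_zero]
    have h := hmin hmem
    rw [Set.mem_setOf_eq, landauFunctional_add, laplace_smul] at h
    simp only [Pi.smul_apply, smul_eq_mul] at h
    have h3 : ∑ x : Site P j, t * laplace c δ x * diverg c (gaugeShift c l₀ A) x
        = t * ∑ x : Site P j, laplace c δ x * diverg c (gaugeShift c l₀ A) x := by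
      rw [Finset.mul_sum]; exact Finset.sum_congr rfl fun x _ => by ring
    have h4 : ∑ x : Site P j, (t * laplace c δ x) ^ 2 = t ^ 2 * ∑ x : Site P j, laplace c δ x ^ 2 := by
      rw [Finset.mul_sum]; exact Finset.sum_congr rfl fun x _ => by ring
    rw [h3, h4] at h
    linarith
  have hq : 0 ≤ w * ∑ x : Site P j, laplace c δ x ^ 2 :=
    mul_nonneg hw.le (Finset.sum_nonneg fun x _ => sq_nonneg _)
  have hb := eq_zero_of_quadratic_min hq hline
  rcases mul_eq_zero.1 hb with h | h
  · exact absurd h hw.ne'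
  · exact h

/-- **(2.9) ⟹ (2.8)** (the functional is a convex quadratic on each orbit): if `A^{λ₀}` satisfies the Euler equation (2.9)
(`IsLandauGauge c (A^{λ₀})`, `λ₀ ∈ N(Q′)`), then `λ₀` minimises (2.8) over `N(Q′)` — indeed
`F(λ) = F(λ₀) + w·Σ_x (Δ(λ − λ₀))(x)² ≥ F(λ₀)` (any `w ≥ 0`). [cite: Balaban1984PropagatorsII, (2.8) p.224] -/
theorem isMinOn_of_isLandauGauge {w : ℝ} (hw : 0 ≤ w) (c : ℝ) (A : VecField P j ℝ) {l₀ : SiteField P j ℝ}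
    (h₀ : siteAvg l₀ = 0) (hL : IsLandauGauge c (gaugeShift c l₀ A)) :
    IsMinOn (landauFunctional w c A) {lam | siteAvg lam = 0} l₀ := by
  intro lam hlam
  rw [Set.mem_setOf_eq] at hlam ⊢
  have hδ : siteAvg (lam - l₀) = 0 := by rw [siteAvg_sub, hlam, h₀, sub_zero]
  have h := landauFunctional_add w c A l₀ (lam - l₀)
  rw [add_sub_cancel, hL _ hδ, mul_zero, sub_zero] at h
  rw [h]
  exact le_add_of_nonneg_right (mul_nonneg hw (Finset.sum_nonneg fun x _ => sq_nonneg _))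

/-- **(2.8) ⟺ (2.9), one level on V1**: for `w > 0` and `λ₀ ∈ N(Q′)`, `λ₀` minimises `Σ w|(∂*A)(x) − (Δλ)(x)|²` over `N(Q′)` iff
`A^{λ₀}` satisfies (2.9)/(2.12). [cite: Balaban1984PropagatorsII, (2.9) p.224] -/
theorem isMinOn_iff_isLandauGauge {w : ℝ} (hw : 0 < w) (c : ℝ) (A : VecField P j ℝ) {l₀ : SiteField P j ℝ}
    (h₀ : siteAvg l₀ = 0) :
    IsMinOn (landauFunctional w c A) {lam | siteAvg lam = 0} l₀ ↔ IsLandauGauge c (gaugeShift c l₀ A) :=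
  ⟨isLandauGauge_of_isMinOn hw c A h₀, isMinOn_of_isLandauGauge hw.le c A h₀⟩

/-- the `λ₀ = 0` reading: `A` itself is in the Landau gauge (2.12) «R∂*A = 0 if we take A^{λ₀} as A» iff `λ = 0` minimises (2.8)
on the orbit of `A`. [cite: Balaban1984PropagatorsII, (2.12) p.225] -/
theorem isLandauGauge_iff_isMinOn_zero {w : ℝ} (hw : 0 < w) (c : ℝ) (A : VecField P j ℝ) :
    IsLandauGauge c A ↔ IsMinOn (landauFunctional w c A) {lam | siteAvg lam = 0} 0 := by
  have h0 : siteAvg (0 : SiteField P j ℝ) = 0 := B5AveragingLocalityV1.siteAvg_zero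
  rw [isMinOn_iff_isLandauGauge hw c A h0]
  have hA : gaugeShift c (0 : SiteField P j ℝ) A = A := by
    funext b; simp [gaugeShift, grad]
  rw [hA]

/-! ## §2  «this equation has exactly one solution … Thus the functional (2.8) has exactly one minimum on each orbit» -/

/-- `Q′λ = 0 ∧ Δλ = 0 ⇒ λ = 0` at every level `j` («the Laplace operator Δ is positive on the subspace N(Q′), hence it is
invertible on this subspace», p. 225; kernel of `Δ` = constants, `B5Positivity172Lattice.const_of_laplace_eq_zero`, and `Q′` of a
constant is the constant). [cite: Balaban1984PropagatorsII, (2.11) p.225] -/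
theorem eq_zero_of_siteAvg_eq_zero_of_laplace_eq_zero {c : ℝ} (hc : c ≠ 0) {lam : SiteField P j ℝ}
    (hQ : siteAvg lam = 0) (hΔ : laplace c lam = 0) : lam = 0 := by
  have hconst : lam = fun _ => lam default :=
    funext fun x => B5Positivity172Lattice.const_of_laplace_eq_zero hc hΔ x
  have hv : lam default = 0 := by
    have h := congrFun hQ (default : Site P (j + 1))
    rw [hconst, siteAvg_const] at h
    exact h
  rw [hconst, hv]
  rfl

/-- **UNIQUENESS of the Landau representative on each orbit** («this equation has exactly one solution», p. 225): two gauge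
functions `λ₁, λ₂ ∈ N(Q′)` with `A^{λ₁}`, `A^{λ₂}` both satisfying (2.9) coincide (`c ≠ 0`) — subtracting the two Euler equations
at `δλ = λ₁ − λ₂` gives `Σ_x (Δδλ)(x)² = 0`. [cite: Balaban1984PropagatorsII, (2.12) p.225] -/
theorem landauGauge_unique {c : ℝ} (hc : c ≠ 0) (A : VecField P j ℝ) {l₁ l₂ : SiteField P j ℝ}
    (h₁ : siteAvg l₁ = 0) (h₂ : siteAvg l₂ = 0)
    (hL₁ : IsLandauGauge c (gaugeShift c l₁ A)) (hL₂ : IsLandauGauge c (gaugeShift c l₂ A)) : l₁ = l₂ := by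
  set δ := l₁ - l₂ with hδdef
  have hδ : siteAvg δ = 0 := by rw [hδdef, siteAvg_sub, h₁, h₂, sub_zero]
  have e₁ := hL₁ δ hδ
  have e₂ := hL₂ δ hδ
  have hsq : ∑ x : Site P j, laplace c δ x ^ 2 = 0 := by
    have h : ∑ x : Site P j, laplace c δ x ^ 2
        = ∑ x : Site P j, laplace c δ x * diverg c (gaugeShift c l₂ A) x
          - ∑ x : Site P j, laplace c δ x * diverg c (gaugeShift c l₁ A) x := by
      rw [← Finset.sum_sub_distrib]
      refine Finset.sum_congr rfl fun x _ => ?_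
      rw [diverg_gaugeShift_apply, diverg_gaugeShift_apply, hδdef, laplace_sub, Pi.sub_apply]
      ring
    rw [h, e₁, e₂, sub_zero]
  have hΔ : laplace c δ = 0 := by
    funext x
    have hx := (Finset.sum_eq_zero_iff_of_nonneg fun y _ => sq_nonneg (laplace c δ y)).1 hsq x (Finset.mem_univ x)
    exact pow_eq_zero_iff two_ne_zero |>.1 hx
  have h0 : δ = 0 := eq_zero_of_siteAvg_eq_zero_of_laplace_eq_zero hc hδ hΔ
  rw [hδdef] at h0
  exact sub_eq_zero.1 h0

/-- **EXISTENCE of the Landau representative on each orbit** («Equation (2.9) implies Δλ₀ = R∂*A», `R` = the orthogonal projection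
onto `ΔN(Q′)` in `L²(T_η)`, p. 225): `Δλ₀ := R∂*A` is solvable with `λ₀ ∈ N(Q′)`, and then `A^{λ₀}` satisfies (2.9) — the
orthogonal projection of `∂*A` onto the (finite-dimensional) subspace `ΔN(Q′)` of `ℓ²(T^{(j)})` (Mathlib's
`Submodule.starProjection`). [cite: Balaban1984PropagatorsII, (2.10) p.225] -/
theorem exists_landauGauge (c : ℝ) (A : VecField P j ℝ) :
    ∃ l₀ : SiteField P j ℝ, siteAvg l₀ = 0 ∧ IsLandauGauge c (gaugeShift c l₀ A) := by
  -- the subspace `ΔN(Q′)` of `ℓ²(T^{(j)})`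
  let K : Submodule ℝ (EuclideanSpace ℝ (Site P j)) :=
    { carrier := {u | ∃ l : SiteField P j ℝ, siteAvg l = 0 ∧ WithLp.ofLp u = laplace c l}
      add_mem' := by
        rintro u v ⟨l, hl, hu⟩ ⟨l', hl', hv⟩
        refine ⟨l + l', by rw [siteAvg_add, hl, hl', add_zero], ?_⟩
        rw [WithLp.ofLp_add, hu, hv, laplace_add]
      zero_mem' := ⟨0, B5AveragingLocalityV1.siteAvg_zero, by rw [WithLp.ofLp_zero, laplace_zero]⟩
      smul_mem' := by
        rintro a u ⟨l, hl, hu⟩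
        refine ⟨a • l, by rw [siteAvg_smul, hl, smul_zero], ?_⟩
        rw [WithLp.ofLp_smul, hu, laplace_smul] }
  let u : EuclideanSpace ℝ (Site P j) := WithLp.toLp 2 (diverg c A)
  have hp : K.starProjection u ∈ K := K.starProjection_apply_mem u
  obtain ⟨l₀, hl₀, hpl⟩ := hp
  refine ⟨l₀, hl₀, fun δ hδ => ?_⟩
  -- `∂*A − Δλ₀ ⊥ ΔN(Q′)`
  have horth := K.sub_starProjection_mem_orthogonal u
  have hmemδ : WithLp.toLp 2 (laplace c δ) ∈ K := ⟨δ, hδ, by rw [WithLp.ofLp_toLp]⟩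
  have h := Submodule.inner_right_of_mem_orthogonal hmemδ horth
  have hsub : u - K.starProjection u = WithLp.toLp 2 (diverg c (gaugeShift c l₀ A)) := by
    apply WithLp.ofLp_injective 2
    rw [WithLp.ofLp_sub, hpl, WithLp.ofLp_toLp, WithLp.ofLp_toLp, diverg_gaugeShift]
    rfl
  rw [hsub] at h
  simpa only [PiLp.inner_apply, RCLike.inner_apply, conj_trivial, PiLp.toLp_apply, mul_comm] using h

/-- **«this equation has exactly one solution»** (p. 225), one level on V1: for `c ≠ 0` and every `A` there is exactly one
`λ₀ ∈ N(Q′)` with `A^{λ₀}` in the Landau gauge (2.9)/(2.12). [cite: Balaban1984PropagatorsII, (2.12) p.225] -/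
theorem existsUnique_landauGauge {c : ℝ} (hc : c ≠ 0) (A : VecField P j ℝ) :
    ∃! l₀ : SiteField P j ℝ, siteAvg l₀ = 0 ∧ IsLandauGauge c (gaugeShift c l₀ A) := by
  obtain ⟨l₀, h₀, hL⟩ := exists_landauGauge c A
  exact ⟨l₀, ⟨h₀, hL⟩, fun l₁ h₁ => landauGauge_unique hc A h₁.1 h₀ h₁.2 hL⟩

/-- **«Thus the functional (2.8) has exactly one minimum on each orbit»** (p. 225), one level on V1: for `w > 0`, `c ≠ 0` and
every `A`, exactly one `λ₀ ∈ N(Q′)` minimises `Σ_x w|(∂*A)(x) − (Δλ)(x)|²` over `N(Q′)`. [cite: Balaban1984PropagatorsII, (2.12) p.225] -/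
theorem existsUnique_isMinOn {w : ℝ} (hw : 0 < w) {c : ℝ} (hc : c ≠ 0) (A : VecField P j ℝ) :
    ∃! l₀ : SiteField P j ℝ, siteAvg l₀ = 0 ∧ IsMinOn (landauFunctional w c A) {lam | siteAvg lam = 0} l₀ := by
  obtain ⟨l₀, ⟨h₀, hL⟩, huniq⟩ := existsUnique_landauGauge hc A
  refine ⟨l₀, ⟨h₀, (isMinOn_iff_isLandauGauge hw c A h₀).2 hL⟩, fun l₁ h₁ => ?_⟩
  exact huniq l₁ ⟨h₁.1, (isMinOn_iff_isLandauGauge hw c A h₁.1).1 h₁.2⟩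

/-- the minimum value is orbit-intrinsic: both Landau representatives of one orbit coincide, `A^{λ₁} = A^{λ₂}`.
[cite: Balaban1984PropagatorsII, (2.12) p.225] -/
theorem landauRep_unique {c : ℝ} (hc : c ≠ 0) (A : VecField P j ℝ) {l₁ l₂ : SiteField P j ℝ}
    (h₁ : siteAvg l₁ = 0) (h₂ : siteAvg l₂ = 0)
    (hL₁ : IsLandauGauge c (gaugeShift c l₁ A)) (hL₂ : IsLandauGauge c (gaugeShift c l₂ A)) :
    gaugeShift c l₁ A = gaugeShift c l₂ A := by
  rw [landauGauge_unique hc A h₁ h₂ hL₁ hL₂]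

/-- two fields of ONE orbit that are both in the Landau gauge are EQUAL (the gauge condition (2.12) fixes the residual one-level
gauge freedom `A ↦ A − ∂λ`, `Q′λ = 0`, completely). [cite: Balaban1984PropagatorsII, (2.12) p.225] -/
theorem eq_of_isLandauGauge_of_gaugeShift {c : ℝ} (hc : c ≠ 0) {A : VecField P j ℝ} {lam : SiteField P j ℝ}
    (hlam : siteAvg lam = 0) (hA : IsLandauGauge c A) (hA' : IsLandauGauge c (gaugeShift c lam A)) :
    gaugeShift c lam A = A := by
  have h0 : siteAvg (0 : SiteField P j ℝ) = 0 := B5AveragingLocalityV1.siteAvg_zero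
  have hA0 : gaugeShift c (0 : SiteField P j ℝ) A = A := by funext b; simp [gaugeShift, grad]
  have h := landauGauge_unique hc A hlam h0 hA' (by rw [hA0]; exact hA)
  rw [h, hA0]

/-! ## §3  (2.12) «R∂*A = 0»: the one-level V1 Landau gauge IS the `k = 1` Landau subspace of [B5] (1.47) / [BIJ85] (4.4.2) -/

open B5SectBStatements B5Eq147Landau B5Eq117TorusCarriers B5Eq147TorusBridge
open Literature.MathematicalPhysics.QuantumFieldTheory.BalabanImbrieJaffe1984to88.BIJ85AxialPropagator411 (BondSpace)
open Literature.MathematicalPhysics.QuantumFieldTheory.BalabanImbrieJaffe1984to88.BIJ85LandauMinimizer442V1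

/-- `Q′₁ = Q′` (one block-averaging step). [cite: Balaban1984PropagatorsI, (1.20) p.20] -/
theorem siteAvgIter_one (lam : SiteField P 0 ℝ) : siteAvgIter 1 lam = siteAvg lam := rfl

/-- rescaling: (2.9) with the lattice factor `c ≠ 0` ⟺ (2.9) with the lattice factor `1`.
[cite: Balaban1984PropagatorsII, (2.9) p.224] -/
theorem isLandauGauge_iff_one {c : ℝ} (hc : c ≠ 0) (A : VecField P j ℝ) : IsLandauGauge c A ↔ IsLandauGauge 1 A := by
  have key : ∀ (dl : SiteField P j ℝ), ∑ x : Site P j, laplace c dl x * diverg c A x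
      = c ^ 2 * c * ∑ x : Site P j, laplace 1 dl x * diverg 1 A x := by
    intro dl
    rw [laplace_eq_smul c, diverg_eq_smul c, Finset.mul_sum]
    exact Finset.sum_congr rfl fun x _ => by simp only [Pi.smul_apply, smul_eq_mul]; ring
  have hc3 : c ^ 2 * c ≠ 0 := mul_ne_zero (pow_ne_zero 2 hc) hc
  constructor
  · intro h dl hdl
    have h1 := h dl hdl
    rw [key] at h1
    exact (mul_eq_zero.1 h1).resolve_left hc3
  · intro h dl hdl
    rw [key, h dl hdl, mul_zero]

/-- **(2.12) on the finest lattice = the `k = 1` Landau subspace of the torus tower**: for `c ≠ 0` and `1 ≤ m + K`, a bond field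
`A` on `T^{(0)}` is in r18's one-level Landau gauge iff its transport lies in `B5Eq147Landau.Lan L (Mk P 1) 1 = ker(R∘∂*)` («R∂*A = 0»,
[B5] (1.47) at `k = 1`). [cite: Balaban1984PropagatorsII, (2.12) p.225] -/
theorem isLandauGauge_iff_tV_mem_Lan (h1 : 1 ≤ P.m + P.K) {c : ℝ} (hc : c ≠ 0) (A : VecField P 0 ℝ) :
    IsLandauGauge c A ↔ tV h1 A ∈ Lan P.L (Mk P 1) 1 := by
  rw [isLandauGauge_iff_one hc, tV_mem_Lan_iff_sum h1 A]
  constructor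
  · intro h lam hlam
    rw [siteAvgIter_one] at hlam
    have h2 := h lam hlam
    rw [← h2]
    exact Finset.sum_congr rfl fun x _ => mul_comm _ _
  · intro h dl hdl
    have h2 := h dl (by rw [siteAvgIter_one]; exact hdl)
    rw [← h2]
    exact Finset.sum_congr rfl fun x _ => mul_comm _ _

/-- **(2.12) on the finest lattice = p38's V1 Landau subspace at `k = 1`**: `IsLandauGauge c A ↔ toLp A ∈ B5Eq164LandauV1.lan P 1 c′ s′`
(every `c, c′, s′ ≠ 0`). [cite: Balaban1984PropagatorsII, (2.12) p.225] -/
theorem isLandauGauge_iff_mem_lan {c c' s' : ℝ} (hc : c ≠ 0) (hc' : c' ≠ 0) (hs' : s' ≠ 0) (A : VecField P 0 ℝ) :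
    IsLandauGauge c A ↔ WithLp.toLp 2 A ∈ B5Eq164LandauV1.lan P 1 c' s' := by
  rw [isLandauGauge_iff_one hc, mem_lan_iff_sum 1 hc' hs', WithLp.ofLp_toLp]
  constructor
  · intro h lam hlam
    rw [siteAvgIter_one] at hlam
    have h2 := h lam hlam
    rw [← h2]
    exact Finset.sum_congr rfl fun x _ => mul_comm _ _
  · intro h dl hdl
    have h2 := h dl (by rw [siteAvgIter_one]; exact hdl)
    rw [← h2]
    exact Finset.sum_congr rfl fun x _ => mul_comm _ _

/-- **(2.12) LITERALLY, «R∂*A = 0»**, on the finest lattice: with `R` = the orthogonal projection onto `ΔN(Q′)` (p11's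
`LandauOps.projR` of the V1 instance `opsV1 P 1 c′ s′`), `IsLandauGauge c A ↔ R ∂*A = 0` (`c, c′, s′ ≠ 0`).
[cite: Balaban1984PropagatorsII, (2.12) p.225] -/
theorem isLandauGauge_iff_projR_eq_zero {c c' s' : ℝ} (hc : c ≠ 0) (hc' : c' ≠ 0) (hs' : s' ≠ 0) (A : VecField P 0 ℝ) :
    IsLandauGauge c A ↔
      (opsV1 P 1 c' s').projR ((opsV1 P 1 c' s').dstar (WithLp.toLp 2 A : BondSpace P)) = 0 := by
  rw [← B5Eq164LandauV1.mem_lan, isLandauGauge_iff_mem_lan hc hc' hs']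

end

end B6Eq28LandauGaugeV1

end Literature.MathematicalPhysics.QuantumFieldTheory.Balaban1983to89
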